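import Summits.BirchSwinnertonDyer.BirchSwinnertonDyer.Theorems.EisensteinPrimesCharResidualSelmerFinite
import Summits.BirchSwinnertonDyer.BirchSwinnertonDyer.Theorems.SchneiderFreeAdditiveX3LocalTowerTorsionLine
import Literature.NumberTheory.EllipticCurves.SupersingularInertiaNoFixedPointProofs
import HarnessLib

/-!
# A Teichmüller character ramified at `v̄` stays non-trivial on the inertia group OF `K_∞` above `v̄`;
# hence `(F/𝒪)(ω̃)` and `𝔽(ω̃)` have no non-zero vector fixed by `ker κ ⊓ I_v̄`
# (cell `bsd-eis`, seat `bsd-line-x1-p1-w4` gen 3, D-0154 WIDTH PASS; crux 2 `GoodLatticeBDPValue`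
# stmt-BirchSwinnertonDyer-19032, line `halves` v19.1, V21 INDEX ROAD step (8), `ω̃` half: the hypothesis of
# `CharResidualSelmerCount.grSelmer_eq_unrSelmer_of_noFixed`, and of `A_ω^{I_j} = 0` / `N_ω^{G_j} = 0` in step (5))

HONEST FRAMING (cell `bsd-eis`, run/shared/lean/pub/bsd-eis/): group-theoretic bookkeeping on constructed
objects; no definition, no named fact, no `sorry`, no `Theses` import; nothing about any curve is asserted;
BSD / IMC2 / KY Thm. 1.4.1 are proved for NO curve. Helper `--supports stmt-BirchSwinnertonDyer-19032`.

## Why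
KY (arXiv:2402.12781v2 TeX L1043): «`H⁰(I_{w,∞}, 𝔽(ω)) = 0` because `ω` is ramified and `I_w/I_{w,∞}` is a
pro-`p` group while the trivializing extension of `ω` has order dividing `p − 1`». The V21 index road uses this
at three places: `N_ω^{G_j} = 0`, `A_ω^{G_j} = 0` (step (5)) and `A_ω^{I_j} = 0` (step (8): `L_ω = 0`, i.e.
`λ_nr(ω̃) = λ_str(ω̃)` — the hypothesis `hI` of this seat's `grSelmer_eq_unrSelmer_of_noFixed`, p642211). In the
tree's currency (`θ : Γ_K → GL₁(𝒪)` with `θ^{p−1} = 1`, `unitChar θ : Γ_K →ₜ* ℤ_p^×`, the chosen inertia group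
`GreenbergSelmer.inertia v̄ ≤ Γ_K`, the tower group `κ.kerSubgroup`):

* §1 **`p`-power descent for a finite-order character** (any closed `D ≤ Γ_K`, any `ℤ_p`-extension `κ`):
  if `unitChar θ` kills `D ⊓ ker κ` then it kills `D` — the open kernel of `unitChar θ` contains a layer
  `D ⊓ κ⁻¹(pⁿℤ_p)` (tree `SchneiderFreeAdditiveX3.exists_layerSubgroup_inf_subset`), so `θ(τ)^{pⁿ} = 1 = θ(τ)^{p−1}`,
  and `gcd(pⁿ, p − 1) = 1`. Contrapositive: a `τ ∈ D` with `θ(τ) ≠ 1` yields `g ∈ D ⊓ ker κ` with `θ(g) ≠ 1`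
  (w2 gen 3's `AnomalousLocalTorsion.exists_mem_inf_kerSubgroup_smul_ne` is the same principle for a LINE in a module).
* §2 **no fixed vectors**: an element `g` with `θ(g) ≠ 1` fixes no non-zero vector of `(F/𝒪)(θ)` (Teichmüller:
  `θ(g) − 1 ∈ ℤ_p^×`), nor of any `A ↪ (F/𝒪)(θ)` equivariantly; packaged in the `hI`-shape
  «`∀ m, (∀ g ∈ ker κ, g ∈ I_v̄ → g • m = m) → m = 0`» for `D = I_v̄` (closed: `InertiaFixedPoint.isClosed_inertia`)
  and for `D = D_v̄`.

NOT here: that `θsub` of the residual pair IS ramified at `v̄` (`θsub|_{G_v̄} = ω` at a good anomalous prime: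
the line's dictionary, `IsResidualPairOver` + `Anom`), and the conclusion `grSelmer = unrSelmer` itself (a
three-line corollary of p642211 once its olean is on the farm).

References: [KellerYin2024] §1.3 (arXiv:2402.12781v2 TeX L1040–1044); [GreenbergLNM1716] §4 proof of Prop. 4.8
(p. 109: the `p`-group fixed-point principle); [Washington1997] §13.1; [SerreLocalFields1979] IV §2 (Teichmüller units).
-/

set_option autoImplicit false
set_option linter.dupNamespace false -- the summit namespace `…BirchSwinnertonDyer.BirchSwinnertonDyer.Theorems` (Sub = Summit, D-0017) trips it

noncomputable section

open scoped Classical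

namespace Summit.BirchSwinnertonDyer.BirchSwinnertonDyer.Theorems.CharResidualSelmerCount

open NumberField IsDedekindDomain Field
open Literature.NumberTheory.EllipticCurves Literature.NumberTheory.EllipticCurves.GreenbergSelmer
  Literature.NumberTheory.GaloisRepresentations Literature.NumberTheory.EllipticCurves.KellerYin2024
  Summit.BirchSwinnertonDyer.BirchSwinnertonDyer.Theorems.CharResidualSelmerFinite
  Summit.BirchSwinnertonDyer.BirchSwinnertonDyer.Theorems.SchneiderFreeAdditiveX3
  Summit.BirchSwinnertonDyer.Rank1Residual.X11b

variable {K : Type} [Field K] [NumberField K] {p : ℕ} [hp : Fact p.Prime] (κ : ZpExtension K p)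
  (θ : FramedGaloisRep K (padicCoeffIntegers (∅ : Set (PadicAlgCl p))) 1)

/-! ### §1 `p`-power descent for a finite-order character -/

/-- **If `unitChar θ` (θ^{p−1} = 1) kills `D ⊓ ker κ` for a closed `D ≤ Γ_K`, it kills `D`.** The kernel of
`unitChar θ` is open (finite image) and contains `D ⊓ ker κ`, hence a layer `D ⊓ κ⁻¹(pⁿ ℤ_p)`
(`exists_layerSubgroup_inf_subset`); so for `τ ∈ D`, `θ(τ)^{pⁿ} = 1`, and `θ(τ)^{p−1} = 1`, whence `θ(τ) = 1`
(`gcd(pⁿ, p−1) = 1`). [cite: GreenbergLNM1716, §4 proof of Prop. 4.8 (p. 109)] [cite: KellerYin2024, §1.3 (arXiv:2402.12781v2 TeX L1043)] -/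
theorem unitChar_eq_one_of_forall_inf_kerSubgroup (hθ : ∀ σ : absoluteGaloisGroup K, θ σ ^ (p - 1) = 1)
    (D : Subgroup (absoluteGaloisGroup K)) (hD : IsClosed (D : Set (absoluteGaloisGroup K)))
    (hker : ∀ g ∈ D ⊓ κ.kerSubgroup, unitChar θ g = 1) {τ : absoluteGaloisGroup K} (hτ : τ ∈ D) :
    unitChar θ τ = 1 := by
  have hp1 : 0 < p - 1 := Nat.sub_pos_of_lt hp.out.one_lt
  -- the open kernel of `unitChar θ` contains a layer of `D`
  obtain ⟨n, hn⟩ := exists_layerSubgroup_inf_subset κ D hD (isOpen_ker_unitChar_of_pow_eq_one θ hp1 hθ)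
    (fun g hg ↦ hker g hg)
  have hτn : τ ^ p ^ n ∈ D ⊓ κ.layerSubgroup n :=
    Subgroup.mem_inf.mpr ⟨D.pow_mem hτ _, AcSelmer.pow_prime_pow_mem_layerSubgroup κ τ n⟩
  have h1 : unitChar θ τ ^ p ^ n = 1 := by
    rw [← map_pow]
    exact hn _ hτn
  have h2 : unitChar θ τ ^ (p - 1) = 1 := unitChar_pow_eq_one θ hθ τ
  have hnd : ¬ p ∣ p - 1 := fun h ↦ by
    have := Nat.le_of_dvd hp1 h
    have h1p := hp.out.one_lt
    omega
  have hcop : Nat.Coprime (p ^ n) (p - 1) := (hp.out.coprime_iff_not_dvd.mpr hnd).pow_left n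
  have h := (pow_gcd_eq_one (a := unitChar θ τ) (m := p ^ n) (n := p - 1)).mpr ⟨h1, h2⟩
  rwa [Nat.Coprime.gcd_eq_one hcop, pow_one] at h

/-- **Contrapositive: a `τ ∈ D` with `θ(τ) ≠ 1` yields `g ∈ D ⊓ ker κ` with `θ(g) ≠ 1`** (`D` closed;
`D = I_v̄`: a character RAMIFIED at `v̄` is still non-trivial on the inertia group of `K_∞` above `v̄`).
[cite: KellerYin2024, §1.3 (arXiv:2402.12781v2 TeX L1040–1044)] [cite: GreenbergLNM1716, §4 proof of Prop. 4.8 (p. 109)] -/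
theorem exists_mem_inf_kerSubgroup_unitChar_ne_one (hθ : ∀ σ : absoluteGaloisGroup K, θ σ ^ (p - 1) = 1)
    (D : Subgroup (absoluteGaloisGroup K)) (hD : IsClosed (D : Set (absoluteGaloisGroup K)))
    {τ : absoluteGaloisGroup K} (hτ : τ ∈ D) (hne : unitChar θ τ ≠ 1) :
    ∃ g ∈ D ⊓ κ.kerSubgroup, unitChar θ g ≠ 1 := by
  by_contra h
  push Not at h
  exact hne (unitChar_eq_one_of_forall_inf_kerSubgroup κ θ hθ D hD h hτ)

/-! ### §2 No fixed vectors -/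

omit [NumberField K] in
/-- **An element `g` with `θ(g) ≠ 1` fixes no non-zero vector of `(F/𝒪)(θ)`** (`θ^{p−1} = 1`): `θ(g) − 1` is a
unit of `ℤ_p` (Teichmüller), and `(θ(g) − 1)·b = 0`. [cite: SerreLocalFields1979, IV §2 (Teichmüller units)]
[cite: KellerYin2024, Lemma 1.2.4 proof (arXiv:2402.12781v2 TeX L766–772)] -/
theorem charModule_eq_zero_of_smul_eq (hθ : ∀ σ : absoluteGaloisGroup K, θ σ ^ (p - 1) = 1)
    {g : absoluteGaloisGroup K} (hg : unitChar θ g ≠ 1) {b : charModule (∅ : Set (PadicAlgCl p)) θ}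
    (hb : g • b = b) : b = 0 := by
  obtain ⟨z, rfl⟩ := (charModuleEquiv θ).symm.surjective b
  rw [galois_smul_charModuleEquiv_symm] at hb
  have h' := (charModuleEquiv θ).symm.injective hb
  have hupow : ((unitChar θ g : ℤ_[p]ˣ) : ℤ_[p]) ^ (p - 1) = 1 := by
    rw [← Units.val_pow_eq_pow_val, unitChar_pow_eq_one θ hθ, Units.val_one]
  have hu1 : ((unitChar θ g : ℤ_[p]ˣ) : ℤ_[p]) ≠ 1 := fun h1 ↦ hg (Units.ext h1)
  have hunit := isUnit_sub_one_of_pow_sub_one_eq_one_of_ne_one hupow hu1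
  have hz0 : z = 0 := by
    have e : (((unitChar θ g : ℤ_[p]ˣ) : ℤ_[p]) - 1) • z = 0 := by
      rw [sub_smul, one_smul, h', sub_self]
    exact hunit.smul_eq_zero.mp e
  rw [hz0, map_zero]

variable {A : Type} [AddCommGroup A] [DistribMulAction (absoluteGaloisGroup K) A]

omit [NumberField K] in
/-- The same for any `A ↪ (F/𝒪)(θ)` equivariant (e.g. the residual line `𝔽(θ̄)`): a vector of `A` fixed by
`g` with `θ(g) ≠ 1` is `0`. [cite: KellerYin2024, §1.3 (arXiv:2402.12781v2 TeX L1043)] -/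
theorem eq_zero_of_smul_eq_of_hom (hθ : ∀ σ : absoluteGaloisGroup K, θ σ ^ (p - 1) = 1)
    (j : A →+ charModule (∅ : Set (PadicAlgCl p)) θ)
    (hj : ∀ (σ : absoluteGaloisGroup K) (a : A), j (σ • a) = σ • j a) (hinj : Function.Injective j)
    {g : absoluteGaloisGroup K} (hg : unitChar θ g ≠ 1) {a : A} (ha : g • a = a) : a = 0 := by
  apply hinj
  rw [map_zero]
  exact charModule_eq_zero_of_smul_eq θ hθ hg (by rw [← hj, ha])

/-- **`(F/𝒪)(θ)^{ker κ ⊓ I_v̄} = 0` for `θ` RAMIFIED at `v̄`** (some `τ ∈ I_v̄` with `θ(τ) ≠ 1`; `θ^{p−1} = 1`), in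
the `hI`-shape consumed by `grSelmer_eq_unrSelmer_of_noFixed`: no non-zero vector is fixed by every
`g ∈ ker κ ⊓ I_v̄`. V21 step (8): `A_ω^{I_j} = 0`, hence `L_ω = 0` and `λ_nr(ω̃) = λ_str(ω̃)`.
[cite: KellerYin2024, §1.3 (arXiv:2402.12781v2 TeX L1040–1044)] -/
theorem charModule_noFixed_kerSubgroup_inertia (hθ : ∀ σ : absoluteGaloisGroup K, θ σ ^ (p - 1) = 1)
    (vbar : HeightOneSpectrum (𝓞 K)) {τ : absoluteGaloisGroup K} (hτ : τ ∈ inertia vbar)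
    (hne : unitChar θ τ ≠ 1) (b : charModule (∅ : Set (PadicAlgCl p)) θ)
    (hb : ∀ g : absoluteGaloisGroup K, g ∈ κ.kerSubgroup → g ∈ inertia vbar → g • b = b) : b = 0 := by
  obtain ⟨g, hg, hgne⟩ := exists_mem_inf_kerSubgroup_unitChar_ne_one κ θ hθ (inertia vbar)
    (InertiaFixedPoint.isClosed_inertia vbar) hτ hne
  obtain ⟨hgI, hgk⟩ := Subgroup.mem_inf.mp hg
  exact charModule_eq_zero_of_smul_eq θ hθ hgne (hb g hgk hgI)

/-- **`A^{ker κ ⊓ I_v̄} = 0` for `A ↪ (F/𝒪)(θ)`, `θ` ramified at `v̄`** (the residual line `𝔽(ω̃)`: V21 step (5)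
`N_ω^{G_j} = 0` a fortiori, and the residual `hI` of `grSelmer_eq_unrSelmer_of_noFixed`).
[cite: KellerYin2024, §1.3 (arXiv:2402.12781v2 TeX L1040–1044)] -/
theorem noFixed_kerSubgroup_inertia_of_hom (hθ : ∀ σ : absoluteGaloisGroup K, θ σ ^ (p - 1) = 1)
    (j : A →+ charModule (∅ : Set (PadicAlgCl p)) θ)
    (hj : ∀ (σ : absoluteGaloisGroup K) (a : A), j (σ • a) = σ • j a) (hinj : Function.Injective j)
    (vbar : HeightOneSpectrum (𝓞 K)) {τ : absoluteGaloisGroup K} (hτ : τ ∈ inertia vbar)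
    (hne : unitChar θ τ ≠ 1) (a : A)
    (ha : ∀ g : absoluteGaloisGroup K, g ∈ κ.kerSubgroup → g ∈ inertia vbar → g • a = a) : a = 0 := by
  obtain ⟨g, hg, hgne⟩ := exists_mem_inf_kerSubgroup_unitChar_ne_one κ θ hθ (inertia vbar)
    (InertiaFixedPoint.isClosed_inertia vbar) hτ hne
  obtain ⟨hgI, hgk⟩ := Subgroup.mem_inf.mp hg
  exact eq_zero_of_smul_eq_of_hom θ hθ j hj hinj hgne (ha g hgk hgI)

/-- **`(F/𝒪)(θ)` and any `A ↪ (F/𝒪)(θ)` have no non-zero vector fixed by `ker κ ⊓ D_v̄`** when `θ(τ) ≠ 1` for some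
`τ ∈ D_v̄` (`D_v̄` closed in `Γ_K`, image of the compact `Γ_{K_v̄}`): V21 step (5), `A_ω^{G_j} = 0`, and — for a
character non-trivial on `D_v̄` but possibly unramified — the vanishing of the local `H⁰` terms.
[cite: KellerYin2024, Prop. 1.3.4 proof (arXiv:2402.12781v2 §1.3)] -/
theorem noFixed_kerSubgroup_decomp_of_hom (hθ : ∀ σ : absoluteGaloisGroup K, θ σ ^ (p - 1) = 1)
    (j : A →+ charModule (∅ : Set (PadicAlgCl p)) θ)
    (hj : ∀ (σ : absoluteGaloisGroup K) (a : A), j (σ • a) = σ • j a) (hinj : Function.Injective j)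
    (vbar : HeightOneSpectrum (𝓞 K)) {τ : absoluteGaloisGroup K} (hτ : τ ∈ decomp vbar)
    (hne : unitChar θ τ ≠ 1) (a : A)
    (ha : ∀ g : absoluteGaloisGroup K, g ∈ κ.kerSubgroup → g ∈ decomp vbar → g • a = a) : a = 0 := by
  have hD : IsClosed ((decomp vbar : Subgroup (absoluteGaloisGroup K)) : Set (absoluteGaloisGroup K)) := by
    haveI : CompactSpace (absoluteGaloisGroup (vbar.adicCompletion K)) :=
      absoluteGaloisGroup_compactSpace (vbar.adicCompletion K)
    exact (isCompact_range (absGaloisRestrict K (vbar.adicCompletion K)).continuous_toFun).isClosed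
  obtain ⟨g, hg, hgne⟩ := exists_mem_inf_kerSubgroup_unitChar_ne_one κ θ hθ (decomp vbar) hD hτ hne
  obtain ⟨hgD, hgk⟩ := Subgroup.mem_inf.mp hg
  exact eq_zero_of_smul_eq_of_hom θ hθ j hj hinj hgne (ha g hgk hgD)

end Summit.BirchSwinnertonDyer.BirchSwinnertonDyer.Theorems.CharResidualSelmerCount

end
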